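import Summits.AnomalousDissipation.AnomalousDissipation.Theses.NeutralTaylorWaves
import Literature.Analysis.Calculus.SimplifiedNewton
import Mathlib.Analysis.Calculus.FDeriv.Bilinear
import Mathlib.Analysis.Calculus.FDeriv.Prod
import Mathlib.Analysis.Calculus.FDeriv.Add
import Mathlib.Analysis.Calculus.FDeriv.Mul

/-!
# Abstract quantitative Newton step for the quadratic drifted steady map
# (line `Sketch`, crux `NeutralTaylorWaves.NewtonRealisation`, stmt-AnomalousDissipation-16315)

Sorry-free discharge of the registered stub `stub_quadraticNewton` of the skeleton of
`Summit.AnomalousDissipation.AnomalousDissipation.Theses.NeutralTaylorWaves.NewtonRealisation`.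

On a real Banach space `E`, for a bounded bilinear `B` (explicit bound `CB`), a bounded linear `D`
(drift direction), a functional `ℓ` (the border), a scalar `a`, a force `F` and a base point
`(x₀, β₀)`, the drifted steady map is the continuous quadratic polynomial
`Φ (x, β) = (a • x − β • D x + B x x − F, ℓ (x − x₀))` on the Banach space `E × ℝ` (sup norm).
Its derivative at `p = (y, γ)` is `DΦ(p) (h, η) = (a•h − γ•D h − η•D y + B y h + B h y, ℓ h)`, which is
`(2 CB + 2‖D‖)`-Lipschitz in `p`, and `DΦ(x₀, β₀) = A`.  The simplified Newton method
(`Literature.Analysis.Calculus.exists_zero_near_of_simplifiedNewton`, Magnus 2022, Prop. 6.7) with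
`M = 2 CB + 2‖D‖`, `‖A⁻¹‖ ≤ P`, `‖A⁻¹ Φ(x₀, β₀)‖ ≤ P ρ`, `ρ = ‖a•x₀ − β₀•D x₀ + B x₀ x₀ − F‖`, under the
premise `4 M P (P ρ) ≤ 1`, produces a zero `(x, β)` of `Φ` with `max (‖x − x₀‖) |β − β₀| ≤ 2 P ρ`.

References: R. Magnus, *Metric Spaces: A Companion to Analysis* (2022), §6.6, Prop. 6.7;
P. Deuflhard, *Newton Methods for Nonlinear Problems* (2011), §2.1.
-/

set_option linter.dupNamespace false

noncomputable section

open Filter Set Metric Topology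

namespace Summit.AnomalousDissipation.AnomalousDissipation.Theorems.NewtonRealisation.QuadraticNewton

variable {E : Type*} [NormedAddCommGroup E] [NormedSpace ℝ E]

/-- **Derivative of the drifted quadratic steady map.** The map
`Φ (x, β) = (a • x − β • D x + B x x − F, ℓ (x − x₀))` on `E × ℝ` has, at every point `p`, the Fréchet
derivative `(h, η) ↦ (a•h − (p.2 • D h + η • D p.1) + (B p.1 h + B h p.1), ℓ h)`, packaged as a
continuous linear map built from `fst`, `snd`, `smulRight` and `IsBoundedBilinearMap.deriv`. [folklore] -/
theorem hasFDerivAt_quadMap {B : E → E → E}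
    (hBb : IsBoundedBilinearMap ℝ (fun p : E × E => B p.1 p.2)) (D : E →L[ℝ] E) (ℓ : E →L[ℝ] ℝ)
    (a : ℝ) (F x₀ : E) (p : E × ℝ) :
    HasFDerivAt (fun q : E × ℝ => (a • q.1 - q.2 • D q.1 + B q.1 q.1 - F, ℓ (q.1 - x₀)))
      ((a • ContinuousLinearMap.fst ℝ E ℝ -
              (p.2 • D.comp (ContinuousLinearMap.fst ℝ E ℝ) +
                (ContinuousLinearMap.snd ℝ E ℝ).smulRight (D p.1)) +
            (hBb.deriv (p.1, p.1)).comp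
              ((ContinuousLinearMap.fst ℝ E ℝ).prod (ContinuousLinearMap.fst ℝ E ℝ))).prod
        (ℓ.comp (ContinuousLinearMap.fst ℝ E ℝ))) p := by
  have h1 : HasFDerivAt (fun q : E × ℝ => a • q.1) (a • ContinuousLinearMap.fst ℝ E ℝ) p :=
    (hasFDerivAt_fst (𝕜 := ℝ)).const_smul a
  have hD : HasFDerivAt (fun q : E × ℝ => D q.1) (D.comp (ContinuousLinearMap.fst ℝ E ℝ)) p :=
    D.hasFDerivAt.comp p hasFDerivAt_fst
  have h2 : HasFDerivAt (fun q : E × ℝ => q.2 • D q.1)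
      (p.2 • D.comp (ContinuousLinearMap.fst ℝ E ℝ) +
        (ContinuousLinearMap.snd ℝ E ℝ).smulRight (D p.1)) p :=
    (hasFDerivAt_snd (𝕜 := ℝ)).smul hD
  have h3 : HasFDerivAt (fun q : E × ℝ => B q.1 q.1)
      ((hBb.deriv (p.1, p.1)).comp
        ((ContinuousLinearMap.fst ℝ E ℝ).prod (ContinuousLinearMap.fst ℝ E ℝ))) p :=
    HasFDerivAt.comp p (g := fun q : E × E => B q.1 q.2) (f := fun q : E × ℝ => (q.1, q.1))
      (hBb.hasFDerivAt (p.1, p.1))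
      ((hasFDerivAt_fst (𝕜 := ℝ)).prodMk (hasFDerivAt_fst (𝕜 := ℝ)))
  have h4 : HasFDerivAt (fun q : E × ℝ => ℓ (q.1 - x₀)) (ℓ.comp (ContinuousLinearMap.fst ℝ E ℝ)) p :=
    ℓ.hasFDerivAt.comp p ((hasFDerivAt_fst (𝕜 := ℝ)).sub_const x₀)
  exact (((h1.sub h2).add h3).sub_const F).prodMk h4

/-- Evaluation of the packaged derivative of the drifted quadratic steady map at a vector `(h, η)`:
`(a•h − (p.2 • D h + η • D p.1) + (B p.1 h + B h p.1), ℓ h)`. [folklore] -/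
theorem quadMapDeriv_apply {B : E → E → E}
    (hBb : IsBoundedBilinearMap ℝ (fun p : E × E => B p.1 p.2)) (D : E →L[ℝ] E) (ℓ : E →L[ℝ] ℝ)
    (a : ℝ) (p : E × ℝ) (h : E) (η : ℝ) :
    ((a • ContinuousLinearMap.fst ℝ E ℝ -
              (p.2 • D.comp (ContinuousLinearMap.fst ℝ E ℝ) +
                (ContinuousLinearMap.snd ℝ E ℝ).smulRight (D p.1)) +
            (hBb.deriv (p.1, p.1)).comp
              ((ContinuousLinearMap.fst ℝ E ℝ).prod (ContinuousLinearMap.fst ℝ E ℝ))).prod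
        (ℓ.comp (ContinuousLinearMap.fst ℝ E ℝ))) (h, η) =
      (a • h - (p.2 • D h + η • D p.1) + (B p.1 h + B h p.1), ℓ h) :=
  rfl

/-- **Lipschitz bound for the derivative of the drifted quadratic steady map.** With
`‖B x y‖ ≤ CB ‖x‖ ‖y‖`, the packaged derivative `DΦ` satisfies
`‖DΦ(p) − DΦ(p₀)‖ ≤ (2 CB + 2‖D‖) ‖p − p₀‖` (sup norm on `E × ℝ`): indeed
`(DΦ(p) − DΦ(p₀)) (h, η) = (−(p.2 − p₀.2)•D h − η•D (p.1 − p₀.1) + B (p.1 − p₀.1) h + B h (p.1 − p₀.1), 0)`.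
[folklore] -/
theorem quadMapDeriv_sub_le {B : E → E → E}
    (hBb : IsBoundedBilinearMap ℝ (fun p : E × E => B p.1 p.2)) {CB : ℝ} (hCB : 0 ≤ CB)
    (hB : ∀ x y : E, ‖B x y‖ ≤ CB * ‖x‖ * ‖y‖) (D : E →L[ℝ] E) (ℓ : E →L[ℝ] ℝ) (a : ℝ)
    (p p₀ : E × ℝ) :
    ‖(a • ContinuousLinearMap.fst ℝ E ℝ -
              (p.2 • D.comp (ContinuousLinearMap.fst ℝ E ℝ) +
                (ContinuousLinearMap.snd ℝ E ℝ).smulRight (D p.1)) +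
            (hBb.deriv (p.1, p.1)).comp
              ((ContinuousLinearMap.fst ℝ E ℝ).prod (ContinuousLinearMap.fst ℝ E ℝ))).prod
          (ℓ.comp (ContinuousLinearMap.fst ℝ E ℝ)) -
        (a • ContinuousLinearMap.fst ℝ E ℝ -
              (p₀.2 • D.comp (ContinuousLinearMap.fst ℝ E ℝ) +
                (ContinuousLinearMap.snd ℝ E ℝ).smulRight (D p₀.1)) +
            (hBb.deriv (p₀.1, p₀.1)).comp
              ((ContinuousLinearMap.fst ℝ E ℝ).prod (ContinuousLinearMap.fst ℝ E ℝ))).prod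
          (ℓ.comp (ContinuousLinearMap.fst ℝ E ℝ))‖ ≤
      (2 * CB + 2 * ‖D‖) * ‖p - p₀‖ := by
  have hM₀ : 0 ≤ (2 * CB + 2 * ‖D‖) * ‖p - p₀‖ := by
    have := norm_nonneg D
    have := norm_nonneg (p - p₀)
    positivity
  refine ContinuousLinearMap.opNorm_le_bound _ hM₀ ?_
  rintro ⟨h, η⟩
  rw [sub_apply, quadMapDeriv_apply, quadMapDeriv_apply, Prod.mk_sub_mk, sub_self,
    Prod.norm_mk, norm_zero, max_eq_left (norm_nonneg _)]
  have key : a • h - (p.2 • D h + η • D p.1) + (B p.1 h + B h p.1) -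
        (a • h - (p₀.2 • D h + η • D p₀.1) + (B p₀.1 h + B h p₀.1)) =
      -((p.2 - p₀.2) • D h) - η • D (p.1 - p₀.1) + B (p.1 - p₀.1) h + B h (p.1 - p₀.1) := by
    have e1 : B (p.1 - p₀.1) h = B p.1 h - B p₀.1 h := hBb.map_sub_left
    have e2 : B h (p.1 - p₀.1) = B h p.1 - B h p₀.1 := hBb.map_sub_right
    rw [e1, e2, map_sub, sub_smul, smul_sub]
    abel
  rw [key]
  have hh : ‖h‖ ≤ ‖(h, η)‖ := norm_fst_le (h, η)
  have hη : ‖η‖ ≤ ‖(h, η)‖ := norm_snd_le (h, η)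
  have h1 : ‖p.1 - p₀.1‖ ≤ ‖p - p₀‖ := norm_fst_le (p - p₀)
  have h2 : ‖p.2 - p₀.2‖ ≤ ‖p - p₀‖ := norm_snd_le (p - p₀)
  have t1 : ‖-((p.2 - p₀.2) • D h)‖ ≤ ‖D‖ * ‖p - p₀‖ * ‖(h, η)‖ := by
    rw [norm_neg, norm_smul]
    calc ‖p.2 - p₀.2‖ * ‖D h‖ ≤ ‖p - p₀‖ * (‖D‖ * ‖(h, η)‖) :=
          mul_le_mul h2 ((D.le_opNorm h).trans (by gcongr)) (norm_nonneg _) (norm_nonneg _)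
      _ = ‖D‖ * ‖p - p₀‖ * ‖(h, η)‖ := by ring
  have t2 : ‖η • D (p.1 - p₀.1)‖ ≤ ‖D‖ * ‖p - p₀‖ * ‖(h, η)‖ := by
    rw [norm_smul]
    calc ‖η‖ * ‖D (p.1 - p₀.1)‖ ≤ ‖(h, η)‖ * (‖D‖ * ‖p - p₀‖) :=
          mul_le_mul hη ((D.le_opNorm _).trans (by gcongr)) (norm_nonneg _) (norm_nonneg _)
      _ = ‖D‖ * ‖p - p₀‖ * ‖(h, η)‖ := by ring
  have t3 : ‖B (p.1 - p₀.1) h‖ ≤ CB * ‖p - p₀‖ * ‖(h, η)‖ :=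
    (hB _ _).trans (by gcongr)
  have t4 : ‖B h (p.1 - p₀.1)‖ ≤ CB * ‖p - p₀‖ * ‖(h, η)‖ := by
    refine (hB _ _).trans ?_
    calc CB * ‖h‖ * ‖p.1 - p₀.1‖ ≤ CB * ‖(h, η)‖ * ‖p - p₀‖ := by gcongr
      _ = CB * ‖p - p₀‖ * ‖(h, η)‖ := by ring
  calc ‖-((p.2 - p₀.2) • D h) - η • D (p.1 - p₀.1) + B (p.1 - p₀.1) h + B h (p.1 - p₀.1)‖
      ≤ ‖D‖ * ‖p - p₀‖ * ‖(h, η)‖ + ‖D‖ * ‖p - p₀‖ * ‖(h, η)‖ + CB * ‖p - p₀‖ * ‖(h, η)‖ +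
          CB * ‖p - p₀‖ * ‖(h, η)‖ :=
        norm_add_le_of_le (norm_add_le_of_le (norm_sub_le_of_le t1 t2) t3) t4
    _ = (2 * CB + 2 * ‖D‖) * ‖p - p₀‖ * ‖(h, η)‖ := by ring

/-- **The derivative at the base point is the given bordered operator `A`.** If
`A (h, η) = (a•h − β₀•D h − η•D x₀ + B x₀ h + B h x₀, ℓ h)` for all `(h, η)`, then the packaged
derivative of the drifted quadratic steady map at `(x₀, β₀)` equals `A`. [folklore] -/
theorem quadMapDeriv_base_eq {B : E → E → E}
    (hBb : IsBoundedBilinearMap ℝ (fun p : E × E => B p.1 p.2)) (D : E →L[ℝ] E) (ℓ : E →L[ℝ] ℝ)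
    (a : ℝ) (x₀ : E) (β₀ : ℝ) (A : (E × ℝ) ≃L[ℝ] (E × ℝ))
    (hA : ∀ (h : E) (η : ℝ), A (h, η) = (a • h - β₀ • D h - η • D x₀ + B x₀ h + B h x₀, ℓ h)) :
    (a • ContinuousLinearMap.fst ℝ E ℝ -
              (β₀ • D.comp (ContinuousLinearMap.fst ℝ E ℝ) +
                (ContinuousLinearMap.snd ℝ E ℝ).smulRight (D x₀)) +
            (hBb.deriv (x₀, x₀)).comp
              ((ContinuousLinearMap.fst ℝ E ℝ).prod (ContinuousLinearMap.fst ℝ E ℝ))).prod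
        (ℓ.comp (ContinuousLinearMap.fst ℝ E ℝ)) =
      (A : (E × ℝ) →L[ℝ] (E × ℝ)) := by
  refine ContinuousLinearMap.ext fun q => ?_
  obtain ⟨h, η⟩ := q
  rw [quadMapDeriv_apply hBb D ℓ a (x₀, β₀) h η, ContinuousLinearEquiv.coe_coe, hA, Prod.mk.injEq]
  exact ⟨by abel, rfl⟩

/-- **Abstract quantitative Newton step for the quadratic drifted steady map** (registered stub
`stub_quadraticNewton`).  On a real Banach space `E` with a bounded bilinear `B` (bound `CB`), a
bounded linear `D`, a functional `ℓ`, a scalar `a`, a force `F` and a base point `(x₀, β₀)`: if the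
bordered linearisation `A (h, η) = (a•h − β₀•D h − η•D x₀ + B x₀ h + B h x₀, ℓ h)` is a linear
homeomorphism of `E × ℝ` with `‖A⁻¹‖ ≤ P` and the Kantorovich premise
`4 (2 CB + 2‖D‖) P (P ρ) ≤ 1`, `ρ = ‖a•x₀ − β₀•D x₀ + B x₀ x₀ − F‖`, holds, then there is an exact
solution `(x, β)` of `a•x − β•D x + B x x = F`, `ℓ (x − x₀) = 0` with `‖x − x₀‖, |β − β₀| ≤ 2 P ρ`.
Proof: the simplified Newton method `exists_zero_near_of_simplifiedNewton` on `E × ℝ` for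
`Φ (x, β) = (a•x − β•D x + B x x − F, ℓ (x − x₀))`, whose derivative is `(2 CB + 2‖D‖)`-Lipschitz and
equals `A` at `(x₀, β₀)`, where `‖Φ (x₀, β₀)‖ = ρ` (Magnus 2022, Prop. 6.7, proved in the tree). [folklore] -/
theorem stub_quadraticNewton :
    ∀ {E : Type} [NormedAddCommGroup E] [NormedSpace ℝ E] [CompleteSpace E]
      (B : E → E → E) (CB : ℝ), IsBoundedBilinearMap ℝ (fun p : E × E => B p.1 p.2) →
      0 ≤ CB → (∀ x y : E, ‖B x y‖ ≤ CB * ‖x‖ * ‖y‖) →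
      ∀ (D : E →L[ℝ] E) (ℓ : E →L[ℝ] ℝ) (a : ℝ) (F x₀ : E) (β₀ P : ℝ)
        (A : (E × ℝ) ≃L[ℝ] (E × ℝ)),
      (∀ (h : E) (η : ℝ), A (h, η) = (a • h - β₀ • D h - η • D x₀ + B x₀ h + B h x₀, ℓ h)) →
      ‖(A.symm : (E × ℝ) →L[ℝ] (E × ℝ))‖ ≤ P →
      4 * (2 * CB + 2 * ‖D‖) * P * (P * ‖a • x₀ - β₀ • D x₀ + B x₀ x₀ - F‖) ≤ 1 →
      ∃ (x : E) (β : ℝ), a • x - β • D x + B x x = F ∧ ℓ (x - x₀) = 0 ∧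
        ‖x - x₀‖ ≤ 2 * P * ‖a • x₀ - β₀ • D x₀ + B x₀ x₀ - F‖ ∧
        |β - β₀| ≤ 2 * P * ‖a • x₀ - β₀ • D x₀ + B x₀ x₀ - F‖ := by
  intro E _ _ _ B CB hBb hCB hB D ℓ a F x₀ β₀ P A hA hP hsmall
  -- the drifted quadratic steady map on `E × ℝ` and its derivative field
  set Φ : E × ℝ → E × ℝ := fun q => (a • q.1 - q.2 • D q.1 + B q.1 q.1 - F, ℓ (q.1 - x₀)) with hΦ
  set f' : E × ℝ → (E × ℝ →L[ℝ] E × ℝ) := fun p =>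
    (a • ContinuousLinearMap.fst ℝ E ℝ -
            (p.2 • D.comp (ContinuousLinearMap.fst ℝ E ℝ) +
              (ContinuousLinearMap.snd ℝ E ℝ).smulRight (D p.1)) +
          (hBb.deriv (p.1, p.1)).comp
            ((ContinuousLinearMap.fst ℝ E ℝ).prod (ContinuousLinearMap.fst ℝ E ℝ))).prod
      (ℓ.comp (ContinuousLinearMap.fst ℝ E ℝ)) with hf'
  set ρ : ℝ := ‖a • x₀ - β₀ • D x₀ + B x₀ x₀ - F‖ with hρ
  have hΦ₀ : Φ (x₀, β₀) = (a • x₀ - β₀ • D x₀ + B x₀ x₀ - F, 0) := by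
    simp only [hΦ, sub_self, map_zero]
  have hΦ₀n : ‖Φ (x₀, β₀)‖ = ρ := by
    rw [hΦ₀, Prod.norm_mk, norm_zero, max_eq_left (norm_nonneg _)]
  have hP₀ : 0 ≤ P := (norm_nonneg _).trans hP
  have hM₀ : 0 ≤ 2 * CB + 2 * ‖D‖ := by
    have := norm_nonneg D
    positivity
  -- `‖A⁻¹ Φ(x₀, β₀)‖ ≤ P ρ`
  have hη : ‖A.symm (Φ (x₀, β₀))‖ ≤ P * ρ := by
    calc ‖A.symm (Φ (x₀, β₀))‖ = ‖(A.symm : (E × ℝ) →L[ℝ] (E × ℝ)) (Φ (x₀, β₀))‖ := rfl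
      _ ≤ ‖(A.symm : (E × ℝ) →L[ℝ] (E × ℝ))‖ * ‖Φ (x₀, β₀)‖ :=
          ContinuousLinearMap.le_opNorm _ _
      _ ≤ P * ρ := by
          rw [hΦ₀n]
          exact mul_le_mul_of_nonneg_right hP (norm_nonneg _)
  -- the Kantorovich premise `4 M ‖A⁻¹‖ ‖A⁻¹ Φ(x₀, β₀)‖ ≤ 4 M P (P ρ) ≤ 1`
  have hprem : 4 * (2 * CB + 2 * ‖D‖) * ‖(A.symm : (E × ℝ) →L[ℝ] (E × ℝ))‖ *
      ‖A.symm (Φ (x₀, β₀))‖ ≤ 1 := by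
    have h4M : 0 ≤ 4 * (2 * CB + 2 * ‖D‖) := by positivity
    calc 4 * (2 * CB + 2 * ‖D‖) * ‖(A.symm : (E × ℝ) →L[ℝ] (E × ℝ))‖ * ‖A.symm (Φ (x₀, β₀))‖
        ≤ 4 * (2 * CB + 2 * ‖D‖) * P * (P * ρ) :=
          mul_le_mul (mul_le_mul_of_nonneg_left hP h4M) hη (norm_nonneg _) (mul_nonneg h4M hP₀)
      _ ≤ 1 := hsmall
  obtain ⟨p, hp, hp0, -, -, -⟩ :=
    Literature.Analysis.Calculus.exists_zero_near_of_simplifiedNewton (f := Φ) (f' := f')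
      (a := (x₀, β₀)) (A := A) hM₀ (fun p _ => hasFDerivAt_quadMap hBb D ℓ a F x₀ p)
      (quadMapDeriv_base_eq hBb D ℓ a x₀ β₀ A hA)
      (fun p _ => quadMapDeriv_sub_le hBb hCB hB D ℓ a p (x₀, β₀)) hprem
  obtain ⟨x, β⟩ := p
  -- read off: the zero lies within `2 ‖A⁻¹ Φ(x₀, β₀)‖ ≤ 2 P ρ` of the base point (sup norm)
  have hball : ‖((x, β) : E × ℝ) - (x₀, β₀)‖ ≤ 2 * P * ρ := by
    have h1 := mem_closedBall.1 hp
    rw [dist_eq_norm] at h1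
    calc ‖((x, β) : E × ℝ) - (x₀, β₀)‖ ≤ 2 * ‖A.symm (Φ (x₀, β₀))‖ := h1
      _ ≤ 2 * (P * ρ) := mul_le_mul_of_nonneg_left hη (by norm_num)
      _ = 2 * P * ρ := by ring
  have hzero : (a • x - β • D x + B x x - F, ℓ (x - x₀)) = (0 : E × ℝ) := hp0
  rw [Prod.mk_eq_zero] at hzero
  refine ⟨x, β, sub_eq_zero.1 hzero.1, hzero.2, ?_, ?_⟩
  · exact (norm_fst_le (((x, β) : E × ℝ) - (x₀, β₀))).trans hball
  · rw [← Real.norm_eq_abs]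
    exact (norm_snd_le (((x, β) : E × ℝ) - (x₀, β₀))).trans hball

end Summit.AnomalousDissipation.AnomalousDissipation.Theorems.NewtonRealisation.QuadraticNewton

end
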